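import Literature.Analysis.FluidPDE.SereginZajaczkowski2007
import HarnessLib

/-!
# Seregin–Šverák 2009, (as15): the inputs of its printed proof

Third sibling of `SereginSverakAxisymmetric.lean` (G. Seregin, V. Šverák, *On Type I singularities
of the local axi-symmetric solutions of the Navier–Stokes equations*, Comm. PDE 34 (2009) 171–201
= arXiv:0804.1803; page references to the arXiv version). The accepted file
`SereginSverakOffAxisScaling.lean` vendors the bound (as15) of the proof of Prop. 3.7 (arXiv
p. 10) — Seregin–Zajaczkowski 2007, Prop. 4.1, (4.1), asserted for the rescalings of the pairs
under the conditions of Thm. 3.1 ("As it was shown in [S11], there exists a continuous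
nondecreasing function `Φ` such that …") — as the named fact
`SereginSverak2009.UnitScaleOffAxisBound`, and proves Prop. 3.7 from it, Lemma 3.5 and the
inverse scaling. The accepted file `SereginZajaczkowski2007.lean` vendors Prop. 4.1
(`OffAxisSupBound`), Cor. 4.4 (`OffAxisL6Bound`, the `L₆` bound) and Lemma 2.3
(`L6EpsilonRegularity`) of G. Seregin, W. Zajaczkowski, SIAM J. Math. Anal. 39 (2007) 669–685 =
arXiv:math/0702720 for the HYPOTHESIS CLASS of Prop. 4.1 ("sufficiently smooth axially symmetric
solution": `SereginZajaczkowski2007.IsSmoothAxisymmetricSolutionOn`) and proves the printed proof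
of Prop. 4.1 ("Applying Corollary 4.4 and Lemma 2.3", arXiv p. 7), leaving open "the reduction of
`SereginSverak2009.UnitScaleOffAxisBound` to `OffAxisSupBound` (it needs … the off-axis
smoothness of axially symmetric suitable weak solutions, i.e. the CKN statement …, for a
representative of the `L³` field)".

This file and its two proofs-only siblings `SereginSverakOffAxisTools.lean`,
`SereginSverakOffAxisEpsilon.lean` close that gap in two ways:

* the needed smoothness is vendored here as the named fact
  `SereginSverak2009.OffAxisSmoothRepresentative` — the regularity of the pairs INSIDE THE REGION
  WHERE THE VELOCITY IS ESSENTIALLY BOUNDED (Seregin–Šverák 2009, §2 p. 8: "for any natural `k`,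
  `z = (x,t) ↦ ∇ᵏv(z)` is Hölder continuous … [ESS4], [LS], and [NRS]"; suitability there, §2
  p. 6 / Remark 3.4), which the Type I bound (r3) `√(-t)|u| ≤ C` supplies around every point of
  the shell `Q̃ = 𝒞(1/4,3;2) × ]-2²,0[` of Prop. 4.1 (its times are `< 0`): every pair of the
  unit-scale class `IsTypeIAxisymmetricSolutionOn 3` has a representative `V` (`= u` a.e. on `Q̃`)
  with `(V, p)` in the hypothesis class of Prop. 4.1 on `Q̃` (the consumer's phrasing, SZ2007 p. 4:
  "all spatial derivatives of `u` are Hölder continuous in a vicinity of each point with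
  `y' ≠ 0`"; neither the axis nor CKN partial regularity enters);
* `SereginSverakOffAxisTools.lean` proves from it and `OffAxisSupBound` the reduction left open
  (`unitScaleOffAxisBound_of_offAxisSupBound`), and from it and `OffAxisL6Bound` the `L₆` bound
  for the pairs at hand (`sixthPower_le_of_offAxisL6Bound`);
* `SereginSverakOffAxisEpsilon.lean` proves (as15) WITHOUT the named fact `L6EpsilonRegularity`
  (Lemma 2.3), replacing it by its printed proof — the decay estimate for the pressure (2.2)
  (accepted named fact `seregin_sverak_pressure_decay`, ball form, for distributional solutions)
  iterated along the scales `τ^k/4`, the Hölder step from the `L₆` bound, and "the so-called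
  ε-regularity theory" (accepted named fact `lemarieRieusset_epsilon_regularity`,
  Lemarié-Rieusset 2016, Thm. 14.4, the velocity half) on `Q_{1/4}(z₀)` for the suitable weak
  solution at hand (Remark 3.4, proved: `SuitableOfBounded_holds`):
  `unitScaleOffAxisBound_of_inputs : OffAxisL6Bound → OffAxisSmoothRepresentative →
  seregin_sverak_pressure_decay → lemarieRieusset_epsilon_regularity → UnitScaleOffAxisBound`.

The printed proof of Lemma 2.3 being followed (arXiv:math/0702720, p. 3):

> *Proof.* First, we remark `Q(z₀, 1/4) ⊂ Q̂` for any `z₀ ∈ 𝒞(1,2;1) × ]-1,0[`. It follows from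
> (2.2), Hölder's inequality, and (2.6) that
> `D(z₀,r;p) ≤ c[(r/r₁)D(z₀,r₁;p) + (r₁/r)² m^{1/2} r₁^{1/2}]`, `0 < r ≤ r₁ ≤ 1/4`. For
> `τ ∈ ]0,1[`, let us take `r = τ^{k+1}/4` and `r₁ = τ^k/4` … We can choose `τ` so small …
> The latter inequality may be easily iterated … Given `ε > 0`, we can find an integer number
> `k₀` so that [`c(C + D)` at the scale `τ^{k₀+1}/4`] `≤ ε`. But according to the so-called
> ε-regularity theory, see, for example, [LS], [ESS4], and [S8], the latter implies two bounds:
> `|v(z₀)| ≤ c/r₀` and `|∇v(z₀)| ≤ c/r₀²`, where `r₀ = τ^{k₀+1}/4`.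

## Contents

* the named fact `SereginSverak2009.OffAxisSmoothRepresentative`;
* the bookkeeping of the iteration of Lemma 2.3 with `τ = σ²`: the square roots `s_k = σ^k/2` of
  the scales `r_k = τ^k/4` (`epsHalfScale`), the explicit majorant `decayMajorant c σ a D₀` of
  `D(r_k; z₀)` (`g₀ = D₀`, `g_{k+1} = g_k/2 + c σ⁻⁴ a s_k`, for `cτ ≤ 1/2` and the Hölder bound
  `C(r_k; z₀) ≤ a s_k`), its closed form bound `g_k ≤ (D₀ + k b ρ⁻¹) ρ^k`, `ρ = max(1/2, σ)`, the
  limit `g_k + a s_k → 0`, and the first index `epsIndex` with `g_k + a s_k ≤ η` (the `k₀` of the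
  printed proof, taken minimal so that it is monotone in the data `(a, D₀)`).

## Rendering choices

* `OffAxisSmoothRepresentative` is stated for the unit-scale class the rendered (as15) quantifies
  over (`IsTypeIAxisymmetricSolutionOn 3`: distributional solution on `Q(0,3)`, `u ∈ L³`,
  `p ∈ L^{3/2}`, pointwise axisymmetric slices, Type I bound a.e.) and for the shell `Q̃` of
  Prop. 4.1 only (`Q̃ ⊆ Q(0,3)` with times `< 0`, where (r3) bounds `u` locally), with the
  conclusion exactly the hypothesis structure `IsSmoothAxisymmetricSolutionOn (shellCylOpens (1/4)
  3 2 2) V p` of the accepted Prop. 4.1 plus `u = V` a.e. on `Q̃`; the pressure is not modified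
  (that structure asks nothing of it beyond the suitable weak solution). Discharge path and prior
  art: the `suitable` conjunct is available today from the proved
  `isSuitableWeakSolutionOn_of_bounded` (`NSBoundedSuitableEnergy.lean`, exhaustion of `Q̃` by
  `{t < -1/n}` as in `SuitableOfBounded_holds`) with `IsSuitableWeakSolutionOn.congr_ae`; the
  `k = 0` case of the quoted regularity is the named fact `NSBoundedInteriorContinuity`
  (`NSBoundedInteriorRegularity.lean`); open are its `k ≥ 1` extension (smooth slices with
  spatial derivatives Hölder in space–time) and the symmetry of the continuous representative.
* The bookkeeping definitions `epsHalfScale`, `decayMajorant`, `epsIndex` transcribe the iteration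
  of Seregin–Zajaczkowski 2007, Lemma 2.3 but are kept in the namespace `SereginSverak2009` of the
  reduction of (as15) they serve (its siblings live there).
* The majorant machinery is elementary (`ℝ≥0` sequences); nothing is asserted there.

## References

* G. Seregin, V. Šverák, Comm. PDE 34 (2009) 171–201, arXiv:0804.1803: §2 p. 6 ((b8)–(b10),
  suitability), p. 8 (regularity inside `Q₁`), §3 p. 9 (Thm. 3.1, Remark 3.4), proof of
  Prop. 3.7, (as15) (p. 10). [`SereginSverak2009`]
* G. Seregin, W. Zajaczkowski, SIAM J. Math. Anal. 39 (2007) 669–685, arXiv:math/0702720: §2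
  ((2.2), Lemma 2.3 and its proof, pp. 2–3), §3 p. 4 ("sufficiently smooth"), §4 (Prop. 4.1,
  Cor. 4.4, proof of Prop. 4.1, pp. 5–7), §5 p. 8. [`SereginZajaczkowski2007`]
* L. Escauriaza, G. Seregin, V. Šverák, Russian Math. Surveys 58 (2003) ([ESS4] of the paper);
  O. A. Ladyzhenskaya, G. A. Seregin, J. Math. Fluid Mech. 1 (1999) 356–387 ([LS]).
* P. G. Lemarié-Rieusset, *The Navier–Stokes Problem in the 21st Century*, CRC Press (2016),
  Thm. 14.4. [`LemarieRieusset2016`]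
-/

noncomputable section

open MeasureTheory Set Function Filter Topology TopologicalSpace Module Metric
open scoped NNReal ENNReal

namespace Literature.Analysis.FluidPDE

namespace SereginSverak2009

open SereginZajaczkowski2007

/-- Local notation for physical space `ℝ³ = EuclideanSpace ℝ (Fin 3)`. -/
local notation "ℝ³" => EuclideanSpace ℝ (Fin 3)

/-! ### Inside the region of essential boundedness the pairs are "sufficiently smooth": the representative, as a named fact -/

/-- **Off the axis, the pairs under the conditions of Theorem 3.1 are "sufficiently smooth": the
regularity inside the region of essential boundedness** (Seregin–Šverák 2009, arXiv:0804.1803,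
§2 p. 8, under the standing conditions (b8) "the pair `v ∈ L₃(Q)` and `q ∈ L_{3/2}(Q)` satisfies
the Navier–Stokes equations" and (b10) "`v ∈ L_∞(Q₁)`": "Our solution `v` and `q` has good
properties inside `Q₁`. … for any natural `k`, `z = (x,t) ↦ ∇ᵏv(z)` is Hölder continuous in
`Q̄₂` … The corresponding norms are estimated by constants depending on `‖v‖_{3,Q}`,
`‖q‖_{3/2,Q}`, `‖v‖_{∞,Q₁}` … Proof of this statements can be done by induction and founded in
[ESS4], [LS], and [NRS]"; §2 p. 6: "the pair `v` and `q`, satisfying conditions (b8)–(b10), is in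
fact a suitable weak solution … It is certainly true in `B × ]-1,-a²[`", restated for the standing
assumptions of §3 as Remark 3.4). For the unit-scale class `IsTypeIAxisymmetricSolutionOn 3` (the
conditions of Thm. 3.1 transported to `Q(0, 3)`) the Type I bound (r3) `√(-t) |u| ≤ C` a.e. makes
`u` essentially bounded near every point of the shell `Q̃ = 𝒞(1/4, 3; 2) × ]-2², 0[` of
Seregin–Zajaczkowski 2007, Prop. 4.1 (its times are `< 0`, and `Q̃ ⊆ Q(0, 3)`), so the quoted
regularity applies around every point of `Q̃`; this is the regularity under which Seregin–Šverák
invoke Prop. 4.1 of [S11] for the rescaled pairs in the proof of Prop. 3.7 ((as15), p. 10; in the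
consumer's words, SZ2007 p. 4: "all spatial derivatives of `u` are Hölder continuous in a vicinity
of each point with `y' ≠ 0`", p. 8: "sufficiently smooth to apply Proposition 4.1"). Statement,
in the form consumed: the `L³` field `u` has a representative `V`, equal to `u` a.e. on `Q̃`, such
that `(V, p)` belongs on `Q̃` to the hypothesis class of Prop. 4.1 as rendered by the accepted
`SereginZajaczkowski2007.IsSmoothAxisymmetricSolutionOn` (suitable weak solution on `Q̃`, axially
symmetric at the points of `Q̃`, every slice `C^∞` there, all spatial derivatives locally Hölder
continuous in space–time); the pressure is not modified. Prior art in the tree and discharge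
path: the `suitable` conjunct follows today from the proved `isSuitableWeakSolutionOn_of_bounded`
(`NSBoundedSuitableEnergy.lean`; on the exhaustion of `Q̃` by `{t < -1/n}`, where (r3) bounds `u`,
glued by `IsSuitableWeakSolutionOn.of_exhaustion`, as in `SuitableOfBounded_holds`) and the
a.e.-congruence `IsSuitableWeakSolutionOn.congr_ae`; the case `k = 0` of the quoted regularity
(a continuous representative) is the named fact `NSBoundedInteriorContinuity`
(`NSBoundedInteriorRegularity.lean`, same citation); what remains open is its extension to all
`k ≥ 1` (smooth slices, spatial derivatives Hölder in space–time: [ESS4] Lemma 2.2, [LS]), the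
axial symmetry of the continuous representative following from the pointwise symmetry of the
slices of `u` by continuity. Neither the axis nor the Caffarelli–Kohn–Nirenberg partial
regularity theorem is involved.
[cite: SereginSverak2009, §2 p. 8 (regularity inside the region of essential boundedness) with §2 p. 6 / Remark 3.4] -/
def OffAxisSmoothRepresentative : Prop :=
  ∀ (u : ℝ → ℝ³ → ℝ³) (p : ℝ → ℝ³ → ℝ), IsTypeIAxisymmetricSolutionOn 3 u p →
    ∃ V : ℝ → ℝ³ → ℝ³,
      IsSmoothAxisymmetricSolutionOn (shellCylOpens (1 / 4) 3 2 2) V p ∧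
        ∀ᵐ z ∂(volume.restrict (shellCyl (1 / 4) 3 2 2)), uncurry u z = uncurry V z

/-! ### The iteration of the proof of Lemma 2.3: an explicit majorant -/

section Majorant

/-- The square roots `s_k = σ^k / 2` of the scales `r_k = τ^k / 4`, `τ = σ²`, of the proof of
Seregin–Zajaczkowski 2007, Lemma 2.3 (arXiv p. 3: "`r = τ^{k+1}/4` and `r₁ = τ^k/4` in (2.8)").
[cite: SereginZajaczkowski2007, proof of Lemma 2.3 (arXiv p. 3)] -/
def epsHalfScale (σ : ℝ≥0) (k : ℕ) : ℝ≥0 := σ ^ k / 2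

/-- The majorant `g` of `D(z₀, τ^k/4; p)` produced by the iteration of the proof of Lemma 2.3
(arXiv p. 3: "`D(z₀, τ^{k+1}/4; p) ≤ cτ [D(z₀, τ^k/4; p) + m^{1/2} τ⁻³ τ^{k/2}]` … The latter
inequality may be easily iterated"), in the form `g₀ = D₀`, `g_{k+1} = g_k / 2 + c σ⁻⁴ a s_k`
(`τ = σ²` with `c τ ≤ 1/2`, `a s_k` the Hölder bound on `C(z₀, τ^k/4)`).
[cite: SereginZajaczkowski2007, proof of Lemma 2.3 (arXiv p. 3)] -/
def decayMajorant (c σ a D₀ : ℝ≥0) : ℕ → ℝ≥0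
  | 0 => D₀
  | k + 1 => decayMajorant c σ a D₀ k / 2 + c * (σ ^ 4)⁻¹ * a * epsHalfScale σ k

/-- Unfolding the successor step of the majorant. [folklore] -/
theorem decayMajorant_succ (c σ a D₀ : ℝ≥0) (k : ℕ) :
    decayMajorant c σ a D₀ (k + 1) =
      decayMajorant c σ a D₀ k / 2 + c * (σ ^ 4)⁻¹ * a * epsHalfScale σ k :=
  rfl

/-- The majorant is monotone in the data `(a, D₀)`. [folklore] -/
theorem decayMajorant_mono (c σ : ℝ≥0) {a a' D₀ D₀' : ℝ≥0} (ha : a ≤ a') (hD : D₀ ≤ D₀') :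
    ∀ k, decayMajorant c σ a D₀ k ≤ decayMajorant c σ a' D₀' k
  | 0 => hD
  | k + 1 => by
    rw [decayMajorant_succ, decayMajorant_succ]
    gcongr
    exact decayMajorant_mono c σ ha hD k

/-- Closed-form bound: `g_k ≤ (D₀ + k b ρ⁻¹) ρ^k` with `ρ = max(1/2, σ)`, `b = c σ⁻⁴ a / 2`.
[folklore] -/
theorem decayMajorant_le (c σ a D₀ : ℝ≥0) (k : ℕ) :
    decayMajorant c σ a D₀ k ≤
      (D₀ + k * (c * (σ ^ 4)⁻¹ * a / 2 * (max (1 / 2) σ)⁻¹)) * max (1 / 2) σ ^ k := by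
  set ρ : ℝ≥0 := max (1 / 2) σ with hρ
  set b : ℝ≥0 := c * (σ ^ 4)⁻¹ * a / 2 with hb
  have hρ0 : ρ ≠ 0 := (lt_of_lt_of_le (by norm_num) (le_max_left _ _)).ne'
  have hρ2 : (1 : ℝ≥0) / 2 ≤ ρ := le_max_left _ _
  have hσρ : σ ≤ ρ := le_max_right _ _
  induction k with
  | zero => simp [decayMajorant]
  | succ k ih =>
    rw [decayMajorant_succ]
    have hstep : c * (σ ^ 4)⁻¹ * a * epsHalfScale σ k = b * σ ^ k := by
      simp only [hb, epsHalfScale]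
      ring
    rw [hstep]
    have h1 : decayMajorant c σ a D₀ k / 2 ≤ (D₀ + k * (b * ρ⁻¹)) * ρ ^ k * ρ := by
      calc decayMajorant c σ a D₀ k / 2 ≤ (D₀ + k * (b * ρ⁻¹)) * ρ ^ k / 2 := by gcongr
        _ = (D₀ + k * (b * ρ⁻¹)) * ρ ^ k * (1 / 2) := by ring
        _ ≤ (D₀ + k * (b * ρ⁻¹)) * ρ ^ k * ρ := by gcongr
    have h2 : b * σ ^ k ≤ b * ρ⁻¹ * ρ ^ k * ρ := by
      calc b * σ ^ k ≤ b * ρ ^ k := by gcongr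
        _ = b * ρ⁻¹ * ρ ^ k * ρ := by field_simp
    calc decayMajorant c σ a D₀ k / 2 + b * σ ^ k
        ≤ (D₀ + k * (b * ρ⁻¹)) * ρ ^ k * ρ + b * ρ⁻¹ * ρ ^ k * ρ := add_le_add h1 h2
      _ = (D₀ + ((k + 1 : ℕ) : ℝ≥0) * (b * ρ⁻¹)) * ρ ^ (k + 1) := by push_cast; ring

/-- For `σ < 1` the majorant tends to `0`. [folklore] -/
theorem tendsto_decayMajorant (c a D₀ : ℝ≥0) {σ : ℝ≥0} (hσ : σ < 1) :
    Tendsto (decayMajorant c σ a D₀) atTop (𝓝 0) := by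
  set ρ : ℝ≥0 := max (1 / 2) σ with hρ
  set b' : ℝ≥0 := c * (σ ^ 4)⁻¹ * a / 2 * ρ⁻¹ with hb'
  have hρ1 : ρ < 1 := max_lt (by norm_num) hσ
  have hρ1R : (ρ : ℝ) < 1 := by exact_mod_cast hρ1
  have hρ0R : (0 : ℝ) ≤ ρ := ρ.coe_nonneg
  have hlim : Tendsto (fun k : ℕ => ((D₀ : ℝ) + k * b') * (ρ : ℝ) ^ k) atTop (𝓝 0) := by
    have h1 := tendsto_pow_atTop_nhds_zero_of_lt_one hρ0R hρ1R
    have h2 := tendsto_self_mul_const_pow_of_lt_one hρ0R hρ1R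
    have : Tendsto (fun k : ℕ => (D₀ : ℝ) * (ρ : ℝ) ^ k + (b' : ℝ) * (k * (ρ : ℝ) ^ k)) atTop
        (𝓝 ((D₀ : ℝ) * 0 + (b' : ℝ) * 0)) := (h1.const_mul _).add (h2.const_mul _)
    simp only [mul_zero, add_zero] at this
    refine this.congr fun k => ?_
    ring
  rw [← NNReal.tendsto_coe]
  refine squeeze_zero (fun k => NNReal.coe_nonneg _) (fun k => ?_) hlim
  have := decayMajorant_le c σ a D₀ k
  exact_mod_cast this

/-- The smallness quantity `g_k + a s_k` (bound for `D(z₀, τ^k/4) + C(z₀, τ^k/4)`) tends to `0`.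
[folklore] -/
theorem tendsto_decayMajorant_add (c a D₀ : ℝ≥0) {σ : ℝ≥0} (hσ : σ < 1) :
    Tendsto (fun k => decayMajorant c σ a D₀ k + a * epsHalfScale σ k) atTop (𝓝 0) := by
  have h1 := tendsto_decayMajorant c a D₀ hσ
  have h2 : Tendsto (fun k => a * epsHalfScale σ k) atTop (𝓝 0) := by
    have := (tendsto_pow_atTop_nhds_zero_of_lt_one σ.coe_nonneg (by exact_mod_cast hσ : (σ : ℝ) < 1))
    rw [← NNReal.tendsto_coe]
    have h3 : Tendsto (fun k : ℕ => (a : ℝ) * ((σ : ℝ) ^ k / 2)) atTop (𝓝 ((a : ℝ) * (0 / 2))) :=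
      (this.div_const 2).const_mul _
    simp only [zero_div, mul_zero] at h3
    refine h3.congr fun k => ?_
    simp [epsHalfScale]
  simpa using h1.add h2

/-- Hence some `k` makes it smaller than any `η > 0`. [folklore] -/
theorem exists_decayMajorant_add_le (c a D₀ : ℝ≥0) {σ : ℝ≥0} (hσ : σ < 1) {η : ℝ≥0} (hη : 0 < η) :
    ∃ k, decayMajorant c σ a D₀ k + a * epsHalfScale σ k ≤ η := by
  obtain ⟨k, hk⟩ := ((tendsto_order.1 (tendsto_decayMajorant_add c a D₀ hσ)).2 η hη).exists
  exact ⟨k, hk.le⟩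

/-- The first index at which the smallness quantity is `≤ η`: the `k₀` of the proof of Lemma 2.3
("Given `ε > 0`, we can find an integer number `k₀` so that … `≤ ε`", arXiv p. 3), chosen
minimal so that it is monotone in the data. When no index qualifies (e.g. `σ ≥ 1`, or `η = 0`)
the value is the junk `sInf ∅ = 0`; `epsIndex_spec` needs `σ < 1` and `0 < η`.
[cite: SereginZajaczkowski2007, proof of Lemma 2.3 (arXiv p. 3)] -/
def epsIndex (c σ η a D₀ : ℝ≥0) : ℕ :=
  sInf {k | decayMajorant c σ a D₀ k + a * epsHalfScale σ k ≤ η}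

/-- The defining smallness at `k₀`. [cite: SereginZajaczkowski2007, proof of Lemma 2.3 (arXiv p. 3)] -/
theorem epsIndex_spec (c a D₀ : ℝ≥0) {σ : ℝ≥0} (hσ : σ < 1) {η : ℝ≥0} (hη : 0 < η) :
    decayMajorant c σ a D₀ (epsIndex c σ η a D₀) + a * epsHalfScale σ (epsIndex c σ η a D₀) ≤ η :=
  Nat.sInf_mem (exists_decayMajorant_add_le c a D₀ hσ hη)

/-- `k₀` is monotone in the data `(a, D₀)`. [folklore] -/
theorem epsIndex_mono (c η : ℝ≥0) {σ : ℝ≥0} (hσ : σ < 1) (hη : 0 < η) {a a' D₀ D₀' : ℝ≥0}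
    (ha : a ≤ a') (hD : D₀ ≤ D₀') : epsIndex c σ η a D₀ ≤ epsIndex c σ η a' D₀' := by
  refine csInf_le_csInf (OrderBot.bddBelow _) (exists_decayMajorant_add_le c a' D₀' hσ hη) ?_
  intro k hk
  rw [mem_setOf_eq] at hk ⊢
  exact le_trans (add_le_add (decayMajorant_mono c σ ha hD k)
    (mul_le_mul_of_nonneg_right ha (by positivity))) hk

end Majorant

end SereginSverak2009

end Literature.Analysis.FluidPDE
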